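import Summits.BirchSwinnertonDyer.BirchSwinnertonDyer.Theorems.ManinLocalTwoThreeShimuraKernelCyclicOfFacts
import Summits.BirchSwinnertonDyer.BirchSwinnertonDyer.Theorems.ManinLocalTwoThreeExistsMinimalOptimalDatum
import HarnessLib

/-!
# desc g26 rows 1–2 (`Gamma1PeriodsNotInsideTwiceGamma0Periods`, `ShimuraKernelCyclic`) and E-an-152b BY NAME modulo THREE printed facts
(route `ManinLocalTwoThree`, cell bsd-f2-manin, prover seat p3 gen 20; `--supports stmt-BirchSwinnertonDyer-22967`)

The 3-line glue promised on STATUS: p2 gen 23's `ShimuraKernelCyclicOfFacts.…_of_modularity_CES_Tes75_EXO` (odd part p3 fact-free, `2`-part p3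
⟸ modularity ∧ CES ∧ T-es-75, lattice algebra p2 E-es-190) carried the existence row EXO as an explicit binder; es g40's turnkey
`ExistsMinimalOptimalDatum.existsMinimalOptimalDatum_forall_of_modularity` (landed p764673) discharges it from modularity.  Hence
**`ShimuraCyclic.ShimuraKernelCyclic` — «`Σ(N) ∩ E₀`, i.e. `Λ₀(f)/Λ₁(f)`, is CYCLIC for every modular parametrisation datum» — modulo exactly
{modularity, CES, T-es-75}** (the question asked in print by Derickx–Orlić 2025, MEMO-es §62; CONDITIONAL on three statement-only printed
facts, none discharged; Manin's conjecture and BSD are NOT proved).  No definitions, no sorry.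
[cite: Vatsal2005, Conj. 1.9] [cite: Stevens1989, §2] [cite: Stevens1982, §1.3 Thm. 1.3.1 (b)] [cite: ConradEdixhovenStein2003, §6.1 Lemma 6.1.6]
-/

set_option autoImplicit false
-- lint-debt: the directory name repeats the summit name (sibling precedent `ManinLocalTwoThreeShimuraKernelCyclicOfFacts.lean`)
set_option linter.dupNamespace false

noncomputable section

open Literature.NumberTheory.EllipticCurves Literature.NumberTheory.EllipticCurves.ModularForms
open Summit.BirchSwinnertonDyer.Rank1Residual.ManinAdditive

namespace Summit.BirchSwinnertonDyer.BirchSwinnertonDyer.Theorems.ManinLocalTwoThree.KummerValues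

/-- **desc g26 row 2 `ShimuraKernelCyclic` BY NAME ⟸ {modularity, CES, T-es-75}.** CONDITIONAL. [cite: Vatsal2005, Conj. 1.9] [cite: Stevens1989, §2] -/
theorem shimuraKernelCyclic_of_modularity_CES_Tes75 (hnf : exists_isNewformOf) (hCES : exists_optimal_gamma1ParametrizationData)
    (hSt : optimalGamma1Parametrization_cuspInv_galoisAction) : ShimuraCyclic.ShimuraKernelCyclic :=
  ShimuraKernelCyclicOfFacts.shimuraKernelCyclic_of_modularity_CES_Tes75_EXO hnf hCES hSt
    (ExistsMinimalOptimalDatum.existsMinimalOptimalDatum_forall_of_modularity hnf)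

/-- **desc g26 row 1 `Gamma1PeriodsNotInsideTwiceGamma0Periods` BY NAME ⟸ {modularity, CES, T-es-75}.** CONDITIONAL. [cite: Stevens1989, §2] -/
theorem gamma1PeriodsNotInsideTwice_of_modularity_CES_Tes75 (hnf : exists_isNewformOf) (hCES : exists_optimal_gamma1ParametrizationData)
    (hSt : optimalGamma1Parametrization_cuspInv_galoisAction) : ShimuraCyclic.Gamma1PeriodsNotInsideTwiceGamma0Periods :=
  ShimuraKernelCyclicOfFacts.gamma1PeriodsNotInsideTwice_of_modularity_CES_Tes75_EXO hnf hCES hSt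
    (ExistsMinimalOptimalDatum.existsMinimalOptimalDatum_forall_of_modularity hnf)

/-- **E-an-152b `ShimuraIndexNeFourAtFour` BY NAME via the cyclicity road ⟸ {modularity, CES, T-es-75}** (the CES-free road is
`shimuraIndexNeFourAtFour_of_modularity_Tes75`).  CONDITIONAL. [cite: Stevens1989, §2] -/
theorem shimuraIndexNeFourAtFour_of_modularity_CES_Tes75' (hnf : exists_isNewformOf) (hCES : exists_optimal_gamma1ParametrizationData)
    (hSt : optimalGamma1Parametrization_cuspInv_galoisAction) : ShimuraKernel.ShimuraIndexNeFourAtFour :=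
  ShimuraKernelCyclicOfFacts.shimuraIndexNeFourAtFour_of_modularity_CES_Tes75_EXO hnf hCES hSt
    (ExistsMinimalOptimalDatum.existsMinimalOptimalDatum_forall_of_modularity hnf)

end Summit.BirchSwinnertonDyer.BirchSwinnertonDyer.Theorems.ManinLocalTwoThree.KummerValues

end
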